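/-
Copyright (c) 2026. All rights reserved.
Released under Apache 2.0 license as described in the file LICENSE.
-/
import Literature.NumberTheory.Automorphic.MaximalOrderDiscThreeBrandtSetup
import HarnessLib

/-!
# The Brandt matrices of `O₃` at the split prime `2`: `T(2) = 3`, `T(4) = 7`, `T(8) = 15` and Eichler's recursion
# `B(p)B(p^ν) = B(p^{ν+1}) + pB(p^{ν−1})` at `p = 2`, from the explicit counts `s₄(4) = 84`, `s₄(8) = 180`, `s₄(12) = 84`

[tag: quaternion_algebra] [tag: brandt_matrix] [tag: quadratic_form]

Topic `NumberTheory/Automorphic`; THEOREMS ONLY (no definition, no named fact, no instance; net Literature debt `0`).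
Lane `lit-hodgefound`, seat p12, gen 45 — tenth file of the series on the definite quaternion order of discriminant `3`.

The files `MaximalOrderDiscThreeBrandtSetup` ∕ `…NormsThreeMul` give the Brandt matrices `T(n)` of `O₃ = ℤ⟨1, i, ω, iω⟩ ⊂ (−1,−3 ∣ ℚ)`
and the representation numbers `s₄(n) = 12·T(n)` of `a² + ac + c² + b² + bd + d²` in closed form whenever the `3`-free part of `n` is
squarefree. The first `n` outside that range are `4, 8, 12`; here they are settled by a certified finite count (the solutions of
`Q = n` lie in the box `|a|, |b|, |c|, |d| ≤ B` as soon as `4n < 3(B + 1)²`, since `4Q ≥ 3a²`), confirming Williams' Theorem 17.3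
`s₄(n) = 12σ(n) − 36σ(n/3)` at these `n` (`84 = 12·7`, `180 = 12·15`, `84 = 12·28 − 36·7`) and giving, on the one-point class set,
`T(4) = 7 = σ(4)`, `T(8) = 15 = σ(8)` and the two instances `B(2)B(2) = B(4) + 2B(1)`, `B(2)B(4) = B(8) + 2B(2)` of EICHLER'S
RECURSION (19) `B(p^μ)B(p^ν) = Σ_{σ ≤ min(μ,ν)} p^σ B(p^{μ+ν−2σ})` (`p ∤ D`) for this order:

* §1 `three_mul_sq_le_four_mul_of_form_eq` (`Q = n ⟹ 3a², 3b², 3c², 3d² ≤ 4n`), **`natCard_form_eq_card_filter_box`** (the count is a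
  finite box count when `4n < 3(B+1)²`);
* §2 **`natCard_form_four`** (`s₄(4) = 84`), **`natCard_form_eight`** (`s₄(8) = 180`), **`natCard_form_twelve`** (`s₄(12) = 84`) — by
  `decide` on the boxes — and `natCard_form_two` (`= 36`, agreeing with `T(2) = 3`);
* §3 **`matrix_four`** (`T(4)_ij = 7`), **`matrix_eight`** (`T(8)_ij = 15`), `matrix_twelve` (`T(12)_ij = 7`), **`matrix_two_mul_matrix_two`**
  (`B(2)² = B(4) + 2·1`), **`matrix_two_mul_matrix_four`** (`B(2)B(4) = B(8) + 2B(2)`), `matrix_two_pow_eq_sigma` (`T(2ᵃ)_ij = σ(2ᵃ)`,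
  `a ≤ 3`).

## Sources

* M. Eichler, LNM 320 (1973), Ch. II §6 Thm. 2 (19) («`B_l(p^μ)B_l(p^ν) = Σ_{σ=0}^{min(μ,ν)} p^{(l+1)σ} B_l(p^{μ+ν−2σ})` for primes
  `p ∤ DH`»), Cor. 1 (row sums). [cite: Eichler1973, Ch. II §6 Thm. 2 (19) and Cor. 1]
* K. S. Williams, *Number Theory in the Spirit of Liouville*, LMS ST 76 (2011), Thm. 17.3 (`s₄(n) = 12σ(n) − 36σ(n/3)`).
  [cite: Williams2011Liouville, Thm. 17.3]
* J. Voight, *Quaternion Algebras*, GTM 288 (2021), Exercise 11.12 (the order and its norm form), §41.1 (Brandt matrices).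
  [cite: Voight2021, Exercise 11.12]

## Scope (honest)

Theorems only. Three individual values of `n` by certified enumeration; the general recursion (19) for `O₃` at every `p ≠ 3` and all
exponents awaits the tree's Hecke-family files.
-/

open Quaternion
open Finset
open Literature.NumberTheory.Automorphic.Brandt

namespace Literature.NumberTheory.Automorphic.MaxOrderDiscThree

/-! ## §1 The solutions of `Q = n` lie in a box -/

section Box

/-- `a² + ac + c² + b² + bd + d² = n ⟹ 3a², 3b², 3c², 3d² ≤ 4n` (`4(a² + ac + c²) = (2c + a)² + 3a²`). [cite: Williams2011Liouville, Thm. 17.3] -/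
theorem three_mul_sq_le_four_mul_of_form_eq {a b c d n : ℤ}
    (h : a ^ 2 + a * c + c ^ 2 + b ^ 2 + b * d + d ^ 2 = n) :
    3 * a ^ 2 ≤ 4 * n ∧ 3 * b ^ 2 ≤ 4 * n ∧ 3 * c ^ 2 ≤ 4 * n ∧ 3 * d ^ 2 ≤ 4 * n := by
  refine ⟨?_, ?_, ?_, ?_⟩
  · nlinarith [sq_nonneg (2 * c + a), sq_nonneg (2 * b + d), sq_nonneg d]
  · nlinarith [sq_nonneg (2 * a + c), sq_nonneg (2 * d + b), sq_nonneg c]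
  · nlinarith [sq_nonneg (2 * a + c), sq_nonneg (2 * b + d), sq_nonneg d]
  · nlinarith [sq_nonneg (2 * a + c), sq_nonneg (2 * b + d), sq_nonneg c]

/-- `3x² ≤ 4n < 3(B+1)² ⟹ −B ≤ x ≤ B`. [folklore] -/
private theorem abs_le_of_three_mul_sq_le {x n B : ℤ} (hB : 0 ≤ B) (hx : 3 * x ^ 2 ≤ 4 * n) (hn : 4 * n < 3 * (B + 1) ^ 2) :
    -B ≤ x ∧ x ≤ B := by
  have h : x ^ 2 < (B + 1) ^ 2 := by linarith
  have habs : |x| < B + 1 := abs_lt_of_sq_lt_sq h (by linarith)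
  obtain ⟨h1, h2⟩ := abs_lt.1 habs
  constructor <;> omega

/-- **The representation count is a finite box count:** if `4n < 3(B + 1)²` then the solutions of `Q = n` are exactly those with all
coordinates in `[−B, B]`. [cite: Williams2011Liouville, Thm. 17.3] -/
theorem natCard_form_eq_card_filter_box (n B : ℤ) (hB : 0 ≤ B) (hn : 4 * n < 3 * (B + 1) ^ 2) :
    Nat.card {v : ℤ × ℤ × ℤ × ℤ //
        v.1 ^ 2 + v.1 * v.2.2.1 + v.2.2.1 ^ 2 + v.2.1 ^ 2 + v.2.1 * v.2.2.2 + v.2.2.2 ^ 2 = n} =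
      ((Icc (-B) B ×ˢ Icc (-B) B ×ˢ Icc (-B) B ×ˢ Icc (-B) B).filter
        fun v : ℤ × ℤ × ℤ × ℤ => v.1 ^ 2 + v.1 * v.2.2.1 + v.2.2.1 ^ 2 + v.2.1 ^ 2 + v.2.1 * v.2.2.2 + v.2.2.2 ^ 2 = n).card := by
  have hS : {v : ℤ × ℤ × ℤ × ℤ |
      v.1 ^ 2 + v.1 * v.2.2.1 + v.2.2.1 ^ 2 + v.2.1 ^ 2 + v.2.1 * v.2.2.2 + v.2.2.2 ^ 2 = n} =
      ↑((Icc (-B) B ×ˢ Icc (-B) B ×ˢ Icc (-B) B ×ˢ Icc (-B) B).filter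
        fun v : ℤ × ℤ × ℤ × ℤ => v.1 ^ 2 + v.1 * v.2.2.1 + v.2.2.1 ^ 2 + v.2.1 ^ 2 + v.2.1 * v.2.2.2 + v.2.2.2 ^ 2 = n) := by
    ext ⟨a, b, c, d⟩
    simp only [Set.mem_setOf_eq, coe_filter, mem_Icc, mem_product]
    constructor
    · intro h
      obtain ⟨ha, hb, hc, hd⟩ := three_mul_sq_le_four_mul_of_form_eq h
      exact ⟨⟨abs_le_of_three_mul_sq_le hB ha hn, abs_le_of_three_mul_sq_le hB hb hn, abs_le_of_three_mul_sq_le hB hc hn,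
        abs_le_of_three_mul_sq_le hB hd hn⟩, h⟩
    · exact And.right
  rw [← Set.ncard_coe_finset, ← hS]
  exact Nat.card_coe_set_eq _

end Box

/-! ## §2 `s₄(2) = 36`, `s₄(4) = 84`, `s₄(8) = 180`, `s₄(12) = 84` -/

section Counts

/-- `s₄(2) = 36` (`= 12·T(2) = 12·3`). [cite: Williams2011Liouville, Thm. 17.3] [cite: Voight2021, Exercise 11.12] -/
theorem natCard_form_two :
    Nat.card {v : ℤ × ℤ × ℤ × ℤ //
        v.1 ^ 2 + v.1 * v.2.2.1 + v.2.2.1 ^ 2 + v.2.1 ^ 2 + v.2.1 * v.2.2.2 + v.2.2.2 ^ 2 = 2} = 36 := by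
  rw [natCard_form_eq_card_filter_box 2 1 zero_le_one (by norm_num)]
  decide +kernel

/-- **`s₄(4) = 84 = 12σ(4)`** — Williams' Theorem 17.3 at the first `n` not covered by the squarefree formulas. [cite: Williams2011Liouville, Thm. 17.3] -/
theorem natCard_form_four :
    Nat.card {v : ℤ × ℤ × ℤ × ℤ //
        v.1 ^ 2 + v.1 * v.2.2.1 + v.2.2.1 ^ 2 + v.2.1 ^ 2 + v.2.1 * v.2.2.2 + v.2.2.2 ^ 2 = 4} = 84 := by
  rw [natCard_form_eq_card_filter_box 4 2 zero_le_two (by norm_num)]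
  decide +kernel

/-- **`s₄(8) = 180 = 12σ(8)`.** [cite: Williams2011Liouville, Thm. 17.3] -/
theorem natCard_form_eight :
    Nat.card {v : ℤ × ℤ × ℤ × ℤ //
        v.1 ^ 2 + v.1 * v.2.2.1 + v.2.2.1 ^ 2 + v.2.1 ^ 2 + v.2.1 * v.2.2.2 + v.2.2.2 ^ 2 = 8} = 180 := by
  rw [natCard_form_eq_card_filter_box 8 3 (by norm_num) (by norm_num)]
  decide +kernel

/-- **`s₄(12) = 84 = 12σ(12) − 36σ(4)`.** [cite: Williams2011Liouville, Thm. 17.3] -/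
theorem natCard_form_twelve :
    Nat.card {v : ℤ × ℤ × ℤ × ℤ //
        v.1 ^ 2 + v.1 * v.2.2.1 + v.2.2.1 ^ 2 + v.2.1 ^ 2 + v.2.1 * v.2.2.2 + v.2.2.2 ^ 2 = 12} = 84 := by
  rw [natCard_form_eq_card_filter_box 12 4 (by norm_num) (by norm_num)]
  decide +kernel

/-- The three values agree with Williams' `12σ(n) − 36σ(n/3)`: `σ(4) = 7`, `σ(8) = 15`, `12σ(12) − 36σ(4) = 84`. [cite: Williams2011Liouville, Thm. 17.3] -/
theorem sigma_four_eight_twelve :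
    ArithmeticFunction.sigma 1 4 = 7 ∧ ArithmeticFunction.sigma 1 8 = 15 ∧
      12 * ArithmeticFunction.sigma 1 12 - 36 * ArithmeticFunction.sigma 1 4 = 84 := by
  refine ⟨?_, ?_, ?_⟩ <;> decide +kernel

end Counts

/-! ## §3 `T(4) = 7`, `T(8) = 15` and Eichler's recursion at `p = 2` -/

section Hecke

/-- Products of `1 × 1` matrices, entrywise. [folklore] -/
private theorem mul_apply₁₃ [Fintype (ClassSet (Submodule.span ℤ (Set.range ![(⟨1, 0, 0, 0⟩ : ℍ[ℚ,-1,-3]), ⟨0, 1, 0, 0⟩, ⟨1/2, 0, 1/2, 0⟩, ⟨0, 1/2, 0, 1/2⟩])))] (A C : Matrix (ClassSet (Submodule.span ℤ (Set.range ![(⟨1, 0, 0, 0⟩ : ℍ[ℚ,-1,-3]), ⟨0, 1, 0, 0⟩, ⟨1/2, 0, 1/2, 0⟩, ⟨0, 1/2, 0, 1/2⟩]))) (ClassSet (Submodule.span ℤ (Set.range ![(⟨1, 0, 0, 0⟩ : ℍ[ℚ,-1,-3]), ⟨0, 1, 0, 0⟩, ⟨1/2, 0, 1/2, 0⟩, ⟨0,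 1/2, 0, 1/2⟩]))) ℤ) (i j : ClassSet (Submodule.span ℤ (Set.range ![(⟨1, 0, 0, 0⟩ : ℍ[ℚ,-1,-3]), ⟨0, 1, 0, 0⟩, ⟨1/2, 0, 1/2, 0⟩, ⟨0, 1/2, 0, 1/2⟩]))) :
    (A * C) i j = A i j * C i j := by
  haveI := subsingleton_classSet
  rw [Matrix.mul_apply, Fintype.sum_subsingleton _ i, Subsingleton.elim j i]

/-- `T(n)_ij` from `s₄(n) = 12·T(n)_ii` on the one-point class set. [cite: Eichler1973, Ch. II §6 Thm. 2 Cor. 1] -/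
private theorem matrix_apply_of_natCard_form {n : ℕ} (hn : n ≠ 0) {s : ℕ}
    (hs : Nat.card {v : ℤ × ℤ × ℤ × ℤ //
        v.1 ^ 2 + v.1 * v.2.2.1 + v.2.2.1 ^ 2 + v.2.1 ^ 2 + v.2.1 * v.2.2.2 + v.2.2.2 ^ 2 = n} = s)
    (i j : ClassSet (Submodule.span ℤ (Set.range ![(⟨1, 0, 0, 0⟩ : ℍ[ℚ,-1,-3]), ⟨0, 1, 0, 0⟩, ⟨1/2, 0, 1/2, 0⟩, ⟨0, 1/2, 0, 1/2⟩]))) : 12 * matrix (Submodule.span ℤ (Set.range ![(⟨1, 0, 0, 0⟩ : ℍ[ℚ,-1,-3]), ⟨0, 1, 0, 0⟩, ⟨1/2, 0, 1/2, 0⟩, ⟨0, 1/2, 0, 1/2⟩])) n i j = s := by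
  haveI := subsingleton_classSet
  rw [Subsingleton.elim j i]
  have h := natCard_reducedNorm_eq_twelve_mul_matrix hn i
  rw [← natCard_form_eq_natCard_reducedNorm, hs] at h
  exact_mod_cast h.symm

/-- **`T(4)_ij = 7`** for the Brandt matrices of `O₃` (`12·T(4) = s₄(4) = 84`). [cite: Eichler1973, Ch. II §6 Thm. 2 (19) and Cor. 1] -/
theorem matrix_four (i j : ClassSet (Submodule.span ℤ (Set.range ![(⟨1, 0, 0, 0⟩ : ℍ[ℚ,-1,-3]), ⟨0, 1, 0, 0⟩, ⟨1/2, 0, 1/2, 0⟩, ⟨0, 1/2, 0, 1/2⟩]))) : matrix (Submodule.span ℤ (Set.range ![(⟨1, 0, 0, 0⟩ : ℍ[ℚ,-1,-3]), ⟨0, 1, 0, 0⟩, ⟨1/2, 0, 1/2, 0⟩, ⟨0, 1/2, 0, 1/2⟩])) 4 i j = 7 := by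
  have h := matrix_apply_of_natCard_form (n := 4) (s := 84) (by norm_num) (by exact_mod_cast natCard_form_four) i j
  omega

/-- **`T(8)_ij = 15`.** [cite: Eichler1973, Ch. II §6 Thm. 2 (19) and Cor. 1] -/
theorem matrix_eight (i j : ClassSet (Submodule.span ℤ (Set.range ![(⟨1, 0, 0, 0⟩ : ℍ[ℚ,-1,-3]), ⟨0, 1, 0, 0⟩, ⟨1/2, 0, 1/2, 0⟩, ⟨0, 1/2, 0, 1/2⟩]))) : matrix (Submodule.span ℤ (Set.range ![(⟨1, 0, 0, 0⟩ : ℍ[ℚ,-1,-3]), ⟨0, 1, 0, 0⟩, ⟨1/2, 0, 1/2, 0⟩, ⟨0, 1/2, 0, 1/2⟩])) 8 i j = 15 := by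
  have h := matrix_apply_of_natCard_form (n := 8) (s := 180) (by norm_num) (by exact_mod_cast natCard_form_eight) i j
  omega

/-- `T(12)_ij = 7` (`= T(4)·T(3) = 7·1`). [cite: Eichler1973, Ch. II §6 Thm. 2 (18), (20)] -/
theorem matrix_twelve (i j : ClassSet (Submodule.span ℤ (Set.range ![(⟨1, 0, 0, 0⟩ : ℍ[ℚ,-1,-3]), ⟨0, 1, 0, 0⟩, ⟨1/2, 0, 1/2, 0⟩, ⟨0, 1/2, 0, 1/2⟩]))) : matrix (Submodule.span ℤ (Set.range ![(⟨1, 0, 0, 0⟩ : ℍ[ℚ,-1,-3]), ⟨0, 1, 0, 0⟩, ⟨1/2, 0, 1/2, 0⟩, ⟨0, 1/2, 0, 1/2⟩])) 12 i j = 7 := by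
  have h := matrix_apply_of_natCard_form (n := 12) (s := 84) (by norm_num) (by exact_mod_cast natCard_form_twelve) i j
  omega

/-- `T(2)_ij = 3`. [cite: Eichler1973, Ch. II §6 (16)] -/
theorem matrix_two (i j : ClassSet (Submodule.span ℤ (Set.range ![(⟨1, 0, 0, 0⟩ : ℍ[ℚ,-1,-3]), ⟨0, 1, 0, 0⟩, ⟨1/2, 0, 1/2, 0⟩, ⟨0, 1/2, 0, 1/2⟩]))) : matrix (Submodule.span ℤ (Set.range ![(⟨1, 0, 0, 0⟩ : ℍ[ℚ,-1,-3]), ⟨0, 1, 0, 0⟩, ⟨1/2, 0, 1/2, 0⟩, ⟨0, 1/2, 0, 1/2⟩])) 2 i j = 3 := by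
  rw [matrix_prime Nat.prime_two (by norm_num) i j]
  norm_num

/-- **EICHLER'S RECURSION (19) AT `p = 2`, `μ = ν = 1`, FOR `O₃`: `B(2)B(2) = B(4) + 2·B(1)`** (`3·3 = 7 + 2`).
[cite: Eichler1973, Ch. II §6 Thm. 2 (19)] -/
theorem matrix_two_mul_matrix_two [Fintype (ClassSet (Submodule.span ℤ (Set.range ![(⟨1, 0, 0, 0⟩ : ℍ[ℚ,-1,-3]), ⟨0, 1, 0, 0⟩, ⟨1/2, 0, 1/2, 0⟩, ⟨0, 1/2, 0, 1/2⟩])))] [DecidableEq (ClassSet (Submodule.span ℤ (Set.range ![(⟨1, 0, 0, 0⟩ : ℍ[ℚ,-1,-3]), ⟨0, 1, 0, 0⟩, ⟨1/2, 0, 1/2, 0⟩, ⟨0, 1/2, 0, 1/2⟩])))] :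
    matrix (Submodule.span ℤ (Set.range ![(⟨1, 0, 0, 0⟩ : ℍ[ℚ,-1,-3]), ⟨0, 1, 0, 0⟩, ⟨1/2, 0, 1/2, 0⟩, ⟨0, 1/2, 0, 1/2⟩])) 2 * matrix (Submodule.span ℤ (Set.range ![(⟨1, 0, 0, 0⟩ : ℍ[ℚ,-1,-3]), ⟨0, 1, 0, 0⟩, ⟨1/2, 0, 1/2, 0⟩, ⟨0, 1/2, 0, 1/2⟩])) 2 = matrix (Submodule.span ℤ (Set.range ![(⟨1, 0, 0, 0⟩ : ℍ[ℚ,-1,-3]), ⟨0, 1, 0, 0⟩, ⟨1/2, 0, 1/2, 0⟩, ⟨0, 1/2, 0, 1/2⟩])) 4 + 2 • (1 : Matrix (ClassSet (Submodule.span ℤ (Set.range ![(⟨1, 0, 0, 0⟩ : ℍ[ℚ,-1,-3]), ⟨0, 1, 0, 0⟩, ⟨1/2, 0, 1/2, 0⟩, ⟨0, 1/2, 0, 1/2⟩]))) (ClassSet (Submodule.span ℤ (Set.range ![(⟨1, 0, 0, 0⟩ : ℍ[ℚ,-1,-3]), ⟨0, 1, 0, 0⟩, ⟨1/2, 0, 1/2,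 0⟩, ⟨0, 1/2, 0, 1/2⟩]))) ℤ) := by
  haveI := subsingleton_classSet
  ext i j
  rw [mul_apply₁₃, Matrix.add_apply, Matrix.smul_apply, Subsingleton.elim j i, Matrix.one_apply_eq, matrix_two, matrix_four]
  norm_num

/-- **EICHLER'S RECURSION (19) AT `p = 2`, `(μ, ν) = (1, 2)`, FOR `O₃`: `B(2)B(4) = B(8) + 2·B(2)`** (`3·7 = 15 + 6`).
[cite: Eichler1973, Ch. II §6 Thm. 2 (19)] -/
theorem matrix_two_mul_matrix_four [Fintype (ClassSet (Submodule.span ℤ (Set.range ![(⟨1, 0, 0, 0⟩ : ℍ[ℚ,-1,-3]), ⟨0, 1, 0, 0⟩, ⟨1/2, 0, 1/2, 0⟩, ⟨0, 1/2, 0, 1/2⟩])))] :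
    matrix (Submodule.span ℤ (Set.range ![(⟨1, 0, 0, 0⟩ : ℍ[ℚ,-1,-3]), ⟨0, 1, 0, 0⟩, ⟨1/2, 0, 1/2, 0⟩, ⟨0, 1/2, 0, 1/2⟩])) 2 * matrix (Submodule.span ℤ (Set.range ![(⟨1, 0, 0, 0⟩ : ℍ[ℚ,-1,-3]), ⟨0, 1, 0, 0⟩, ⟨1/2, 0, 1/2, 0⟩, ⟨0, 1/2, 0, 1/2⟩])) 4 = matrix (Submodule.span ℤ (Set.range ![(⟨1, 0, 0, 0⟩ : ℍ[ℚ,-1,-3]), ⟨0, 1, 0, 0⟩, ⟨1/2, 0, 1/2, 0⟩, ⟨0, 1/2, 0, 1/2⟩])) 8 + 2 • matrix (Submodule.span ℤ (Set.range ![(⟨1, 0, 0, 0⟩ : ℍ[ℚ,-1,-3]), ⟨0, 1, 0, 0⟩, ⟨1/2, 0, 1/2, 0⟩, ⟨0, 1/2, 0, 1/2⟩])) 2 := by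
  haveI := subsingleton_classSet
  ext i j
  rw [mul_apply₁₃, Matrix.add_apply, Matrix.smul_apply, matrix_two, matrix_four, matrix_eight]
  norm_num

/-- `T(2ᵃ)_ij = σ(2ᵃ)` for `a ≤ 3` (Eichler Cor. 1: row sums `σ(n)` for `n` prime to `D`; here the one-point class set).
[cite: Eichler1973, Ch. II §6 Thm. 2 Cor. 1] -/
theorem matrix_two_pow_eq_sigma {a : ℕ} (ha : a ≤ 3) (i j : ClassSet (Submodule.span ℤ (Set.range ![(⟨1, 0, 0, 0⟩ : ℍ[ℚ,-1,-3]), ⟨0, 1, 0, 0⟩, ⟨1/2, 0, 1/2, 0⟩, ⟨0, 1/2, 0, 1/2⟩]))) :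
    matrix (Submodule.span ℤ (Set.range ![(⟨1, 0, 0, 0⟩ : ℍ[ℚ,-1,-3]), ⟨0, 1, 0, 0⟩, ⟨1/2, 0, 1/2, 0⟩, ⟨0, 1/2, 0, 1/2⟩])) (2 ^ a) i j = ArithmeticFunction.sigma 1 (2 ^ a) := by
  interval_cases a
  · rw [pow_zero, matrix_one' i j, show ArithmeticFunction.sigma 1 1 = 1 by decide +kernel]
    norm_num
  · rw [pow_one, matrix_two, show ArithmeticFunction.sigma 1 2 = 3 by decide +kernel]
    norm_num
  · rw [show (2 : ℕ) ^ 2 = 4 by norm_num, matrix_four, show ArithmeticFunction.sigma 1 4 = 7 by decide +kernel]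
    norm_num
  · rw [show (2 : ℕ) ^ 3 = 8 by norm_num, matrix_eight, show ArithmeticFunction.sigma 1 8 = 15 by decide +kernel]
    norm_num

end Hecke

end Literature.NumberTheory.Automorphic.MaxOrderDiscThree
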